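import Summits.CriticalPhenomena.PercolationContinuityZ3.Theorems.PercNearOneGluingNoHeavyLowerTailIncStarTwoPortEvents
import Summits.CriticalPhenomena.PercolationContinuityZ3.Theorems.PercNearOneGluingNoHeavyLowerTailIncStarBranchLemmaStep
import HarnessLib

/-!
# The TWO-PORT branch lemma (H), II: the bridge step when the hanging target is on the port's side

Support file for the Sahi programme (`--supports stmt-CriticalPhenomena-4575`, prover prim-sahi-p2 gen 21).  No definitions, no named
facts, no sorries; standard axioms.  Memo `run/shared/lean/prim/prim-sahi/prim-sahi-p2/gen21/THEOREM-H.md` §1 (cases AA, AB).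

Setting of `…IncStarTwoPortEvents`: root `s`, rooted port `u`, unrooted port `v`, an environment bridge `e = s(v, x')` at `v` whose `v`-side
is `L` (`s, x', u ∉ L`), `w0 = w[e↦0]`, and the (H)-events `U_b = {s↔u} ∩ {s↔v}ᶜ ∩ {b↔v}`, `X₃ = {s↔c} ∪ {u↔c} ∪ {v↔c}`,
`X₂ = {s↔c} ∪ {u↔c}`.  Here the hanging target `b` lies in `L`.  Conditioning on `e` (`prodBernoulli_real_oneBond`,
`tieLiftOne_real_one_eq`) and the independence of the blocks `insert s L`, `Lᶜ` (`IncStar.indep_blocks`) factor the four probabilities of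
(H); the inequality for `w` then follows from ONE instance of (H) for `w0` plus Harris:
* `twoPort_step_AA` (`c ∈ L`): from (H)(w0; s, v; b, c) — the one-port instance on the `v`-side;
* `twoPort_step_AB` (`c ∉ L`): from (H)(w0; u, x'; x', c) — the two-port instance one edge shorter — and Harris twice
  (`twoPort_real_AB`: `T(p) = p·[IH] + (1−p)·[(2L₀ − aX₀) − p(a − a′)(X₁ − X₀)]`).
The cases `b ∉ L` are in `…IncStarTwoPortStepFar`; the induction in `…IncStarTwoPortBranchLemma`.
-/

noncomputable section

namespace Summit.CriticalPhenomena.PercolationContinuityZ3.Theorems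

namespace IncStar

open MeasureTheory Set Literature.Probability.Percolation Literature.Probability.LatticeModels EdgeInduction
open scoped Classical

variable {n : ℕ}

/-- **(H), bridge step, case AA** (`b, c` on the port's side `L`): (H)(w[e↦0]; s, v; b, c) ⟹ (H)(w; u, v; b, c). [this work] -/
theorem twoPort_step_AA (w : Sym2 (Fin n) → unitInterval) (L : Set (Fin n)) {s u v x' b c : Fin n}
    (hsL : s ∉ L) (hvL : v ∈ L) (hxL : x' ∉ L) (huL : u ∉ L) (hbL : b ∈ L) (hcL : c ∈ L)
    (hcross : ∀ x y : Fin n, x ∈ L → y ∉ L → y ≠ s → s(x, y) ≠ s(v, x') → w s(x, y) = 0)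
    (IH : (prodBernoulli (Function.update w s(v, x') 0)).real (openConn s s ∩ (openConn s v)ᶜ ∩ openConn b v) *
        (prodBernoulli (Function.update w s(v, x') 0)).real (openConn s c ∪ openConn s c ∪ openConn v c)
      ≤ (prodBernoulli (Function.update w s(v, x') 0)).real
          (openConn s s ∩ (openConn s v)ᶜ ∩ openConn b v ∩ (openConn s c ∪ openConn s c ∪ openConn v c))
        + (prodBernoulli (Function.update w s(v, x') 0)).real
          (openConn s s ∩ (openConn s v)ᶜ ∩ openConn b v ∩ (openConn s c ∪ openConn s c))) :
    (prodBernoulli w).real (openConn s u ∩ (openConn s v)ᶜ ∩ openConn b v) *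
        (prodBernoulli w).real (openConn s c ∪ openConn u c ∪ openConn v c)
      ≤ (prodBernoulli w).real (openConn s u ∩ (openConn s v)ᶜ ∩ openConn b v ∩ (openConn s c ∪ openConn u c ∪ openConn v c))
        + (prodBernoulli w).real (openConn s u ∩ (openConn s v)ᶜ ∩ openConn b v ∩ (openConn s c ∪ openConn u c)) := by
  -- names
  set e : Sym2 (Fin n) := s(v, x')
  set w0 := Function.update w e 0 with hw0
  set w1 := Function.update w e 1
  set U : Set (BondConfig (Fin n)) := openConn s u ∩ (openConn s v)ᶜ ∩ openConn b v
  set X3 : Set (BondConfig (Fin n)) := openConn s c ∪ openConn u c ∪ openConn v c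
  set X2 : Set (BondConfig (Fin n)) := openConn s c ∪ openConn u c
  set SAv : Set (BondConfig (Fin n)) := openConnIn (insert s L) s v
  set SAc : Set (BondConfig (Fin n)) := openConnIn (insert s L) s c
  set NAbv : Set (BondConfig (Fin n)) := openConnIn (insert s L) b v
  set NAvc : Set (BondConfig (Fin n)) := openConnIn (insert s L) v c
  set SBu : Set (BondConfig (Fin n)) := openConnIn Lᶜ s u
  set SBx : Set (BondConfig (Fin n)) := openConnIn Lᶜ s x'
  -- (0) the bridge hypothesis under `w0`, the almost-sure set, independence
  have hsu1 : s ∉ L := hsL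
  have hw0cross : ∀ x y : Fin n, x ∈ L → y ∉ L → y ≠ s → w0 s(x, y) = 0 := by
    intro x y hx hy hys
    by_cases hxy : s(x, y) = e
    · rw [hxy, hw0, Function.update_self]
    · rw [hw0, Function.update_of_ne hxy]; exact hcross x y hx hy hys hxy
  set G : Set (BondConfig (Fin n)) := {ω | ∀ e', w0 e' = 0 → e' ∉ ω}
  have hG1 : (prodBernoulli w0).real G = 1 := real_sureClosed w0
  have hωG : ∀ ω ∈ G, ∀ x y : Fin n, x ∈ L → y ∉ L → y ≠ s → s(x, y) ∉ ω :=
    fun ω hω x y hx hy hys => hω _ (hw0cross x y hx hy hys)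
  have hm : ∀ X : Set (BondConfig (Fin n)), MeasurableSet X := fun _ => MeasurableSet.of_discrete
  have hdiff : ∀ {A B : Set (BondConfig (Fin n))} {K' : Set (Sym2 (Fin n))},
      DeterminedBy A K' → DeterminedBy B K' → DeterminedBy (A \ B) K' := by
    intro A B K' hA hB
    rw [determinedBy_iff] at hA hB ⊢
    intro ω ω' h
    rw [Set.mem_sdiff, Set.mem_sdiff, hA ω ω' h, hB ω ω' h]
  have hinter : ∀ {A B : Set (BondConfig (Fin n))} {K' : Set (Sym2 (Fin n))},
      DeterminedBy A K' → DeterminedBy B K' → DeterminedBy (A ∩ B) K' := by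
    intro A B K' hA hB
    rw [determinedBy_iff] at hA hB ⊢
    intro ω ω' h
    rw [Set.mem_inter_iff, Set.mem_inter_iff, hA ω ω' h, hB ω ω' h]
  have hunion : ∀ {A B : Set (BondConfig (Fin n))} {K' : Set (Sym2 (Fin n))},
      DeterminedBy A K' → DeterminedBy B K' → DeterminedBy (A ∪ B) K' := by
    intro A B K' hA hB
    rw [determinedBy_iff] at hA hB ⊢
    intro ω ω' h
    rw [Set.mem_union, Set.mem_union, hA ω ω' h, hB ω ω' h]
  have hdn : ∀ x y : Fin n, DeterminedBy (openConnIn (insert s L) x y : Set (BondConfig (Fin n)))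
      {z : Sym2 (Fin n) | ¬ z.IsDiag ∧ ∀ x ∈ z, x ∈ insert s L} := fun x y => IncStarCutVertex.determinedBy_openConnIn_offDiag _ x y
  have hdf : ∀ x y : Fin n, DeterminedBy (openConnIn Lᶜ x y : Set (BondConfig (Fin n)))
      {z : Sym2 (Fin n) | ¬ z.IsDiag ∧ ∀ x ∈ z, x ∈ Lᶜ} := fun x y => IncStarCutVertex.determinedBy_openConnIn_offDiag _ x y
  have indep : ∀ {A B : Set (BondConfig (Fin n))}, DeterminedBy A {z : Sym2 (Fin n) | ¬ z.IsDiag ∧ ∀ x ∈ z, x ∈ insert s L} →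
      DeterminedBy B {z : Sym2 (Fin n) | ¬ z.IsDiag ∧ ∀ x ∈ z, x ∈ Lᶜ} →
      (prodBernoulli w0).real (A ∩ B) = (prodBernoulli w0).real A * (prodBernoulli w0).real B :=
    fun hA hB => indep_blocks w0 L s hA hB
  -- (1) one-bond decomposition and the lift
  have ob : ∀ A : Set (BondConfig (Fin n)),
      (prodBernoulli w).real A = (1 - (w e : ℝ)) * (prodBernoulli w0).real A + (w e : ℝ) * (prodBernoulli w1).real A := by
    intro A
    have hA : DeterminedBy A (↑(Finset.univ : Finset (Sym2 (Fin n))) : Set (Sym2 (Fin n))) := by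
      rw [determinedBy_iff]
      intro ω ω' h
      rw [Finset.coe_univ, Set.inter_univ, Set.inter_univ] at h
      rw [h]
    exact prodBernoulli_real_oneBond hA w (Finset.mem_univ e)
  have lift : ∀ A : Set (BondConfig (Fin n)),
      (prodBernoulli w1).real A = (prodBernoulli w0).real ((fun ω : BondConfig (Fin n) => insert e ω) ⁻¹' A) :=
    fun A => tieLiftOne_real_one_eq w e A
  -- (2) the eight moments in block form
  have hDA : DeterminedBy (NAbv \ SAv) {z : Sym2 (Fin n) | ¬ z.IsDiag ∧ ∀ x ∈ z, x ∈ insert s L} := hdiff (hdn b v) (hdn s v)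
  have hZA : DeterminedBy (SAc ∪ NAvc) {z : Sym2 (Fin n) | ¬ z.IsDiag ∧ ∀ x ∈ z, x ∈ insert s L} := hunion (hdn s c) (hdn v c)
  have m1 : (prodBernoulli w0).real U = (prodBernoulli w0).real (NAbv \ SAv) * (prodBernoulli w0).real SBu := by
    rw [← indep hDA (hdf s u)]
    refine real_congr_of_sure hG1 fun ω hω => ?_
    rw [twoPort_mem_U_near L hsL hvL huL (hωG ω hω) hbL, Set.mem_inter_iff, Set.mem_sdiff]
  have m2 : (prodBernoulli w1).real U = (prodBernoulli w0).real (NAbv \ SAv) * (prodBernoulli w0).real (SBu \ SBx) := by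
    rw [lift, ← indep hDA (hdiff (hdf s u) (hdf s x'))]
    refine real_congr_of_sure hG1 fun ω hω => ?_
    rw [Set.mem_preimage, twoPort_lift_U_near L hsL hvL hxL huL (hωG ω hω) hbL, Set.mem_inter_iff, Set.mem_sdiff, Set.mem_sdiff]
  have m3 : (prodBernoulli w0).real X3 = (prodBernoulli w0).real (SAc ∪ NAvc) :=
    real_congr_of_sure hG1 fun ω hω => by rw [twoPort_mem_X3_near L hsL hvL huL (hωG ω hω) hcL, Set.mem_union]
  have m4 : (prodBernoulli w1).real X3 = (prodBernoulli w0).real (SAc ∪ NAvc) := by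
    rw [lift]
    exact real_congr_of_sure hG1 fun ω hω => by
      rw [Set.mem_preimage, twoPort_lift_X3_near L hsL hvL hxL huL (hωG ω hω) hcL, Set.mem_union]
  have m5 : (prodBernoulli w0).real (U ∩ X3)
      = (prodBernoulli w0).real ((NAbv \ SAv) ∩ (SAc ∪ NAvc)) * (prodBernoulli w0).real SBu := by
    rw [← indep (hinter hDA hZA) (hdf s u)]
    refine real_congr_of_sure hG1 fun ω hω => ?_
    rw [Set.mem_inter_iff, twoPort_mem_U_near L hsL hvL huL (hωG ω hω) hbL, twoPort_mem_X3_near L hsL hvL huL (hωG ω hω) hcL]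
    simp only [Set.mem_inter_iff, Set.mem_sdiff, Set.mem_union]
    tauto
  have m6 : (prodBernoulli w1).real (U ∩ X3)
      = (prodBernoulli w0).real ((NAbv \ SAv) ∩ (SAc ∪ NAvc)) * (prodBernoulli w0).real (SBu \ SBx) := by
    rw [lift, ← indep (hinter hDA hZA) (hdiff (hdf s u) (hdf s x'))]
    refine real_congr_of_sure hG1 fun ω hω => ?_
    rw [Set.mem_preimage, Set.mem_inter_iff, twoPort_lift_U_near L hsL hvL hxL huL (hωG ω hω) hbL,
      twoPort_lift_X3_near L hsL hvL hxL huL (hωG ω hω) hcL]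
    simp only [Set.mem_inter_iff, Set.mem_sdiff, Set.mem_union]
    tauto
  have m7 : (prodBernoulli w0).real (U ∩ X2)
      = (prodBernoulli w0).real ((NAbv \ SAv) ∩ SAc) * (prodBernoulli w0).real SBu := by
    rw [← indep (hinter hDA (hdn s c)) (hdf s u)]
    refine real_congr_of_sure hG1 fun ω hω => ?_
    rw [Set.mem_inter_iff]
    constructor
    · rintro ⟨hU, hX⟩
      rw [twoPort_X2_near L hsL huL (hωG ω hω) hcL] at hX
      rw [twoPort_mem_U_near L hsL hvL huL (hωG ω hω) hbL] at hU
      simp only [Set.mem_inter_iff, Set.mem_sdiff]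
      tauto
    · intro h
      simp only [Set.mem_inter_iff, Set.mem_sdiff] at h
      rw [twoPort_X2_near L hsL huL (hωG ω hω) hcL, twoPort_mem_U_near L hsL hvL huL (hωG ω hω) hbL]
      tauto
  have m8 : (prodBernoulli w1).real (U ∩ X2)
      = (prodBernoulli w0).real ((NAbv \ SAv) ∩ SAc) * (prodBernoulli w0).real (SBu \ SBx) := by
    rw [lift, ← indep (hinter hDA (hdn s c)) (hdiff (hdf s u) (hdf s x'))]
    refine real_congr_of_sure hG1 fun ω hω => ?_
    rw [Set.mem_preimage, Set.mem_inter_iff]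
    constructor
    · rintro ⟨hU, hX⟩
      rw [twoPort_lift_X2_near L hsL hvL hxL huL (hωG ω hω) hcL hU] at hX
      rw [twoPort_lift_U_near L hsL hvL hxL huL (hωG ω hω) hbL] at hU
      simp only [Set.mem_inter_iff, Set.mem_sdiff]
      tauto
    · intro h
      simp only [Set.mem_inter_iff, Set.mem_sdiff] at h
      have hU : insert e ω ∈ U := by
        rw [twoPort_lift_U_near L hsL hvL hxL huL (hωG ω hω) hbL]; tauto
      rw [twoPort_lift_X2_near L hsL hvL hxL huL (hωG ω hω) hcL hU]
      exact ⟨hU, h.1.2⟩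
  -- (3) the induction instance in block form (`u := s`)
  have hss : ∀ ω : BondConfig (Fin n), ω ∈ openConnIn Lᶜ s s := fun ω => ⟨hsL, hsL, SimpleGraph.Reachable.refl _⟩
  have i1 : (prodBernoulli w0).real (openConn s s ∩ (openConn s v)ᶜ ∩ openConn b v) = (prodBernoulli w0).real (NAbv \ SAv) :=
    real_congr_of_sure hG1 fun ω hω => by
      rw [twoPort_mem_U_near L hsL hvL hsu1 (hωG ω hω) hbL, Set.mem_sdiff]
      exact ⟨fun h => h.1, fun h => ⟨h, hss ω⟩⟩
  have i2 : (prodBernoulli w0).real (openConn s c ∪ openConn s c ∪ openConn v c) = (prodBernoulli w0).real (SAc ∪ NAvc) :=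
    real_congr_of_sure hG1 fun ω hω => by rw [twoPort_mem_X3_near L hsL hvL hsu1 (hωG ω hω) hcL, Set.mem_union]
  have i3 : (prodBernoulli w0).real (openConn s s ∩ (openConn s v)ᶜ ∩ openConn b v ∩ (openConn s c ∪ openConn s c ∪ openConn v c))
      = (prodBernoulli w0).real ((NAbv \ SAv) ∩ (SAc ∪ NAvc)) :=
    real_congr_of_sure hG1 fun ω hω => by
      rw [Set.mem_inter_iff, twoPort_mem_U_near L hsL hvL hsu1 (hωG ω hω) hbL, twoPort_mem_X3_near L hsL hvL hsu1 (hωG ω hω) hcL]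
      simp only [Set.mem_inter_iff, Set.mem_sdiff, Set.mem_union]
      have := hss ω
      tauto
  have i4 : (prodBernoulli w0).real (openConn s s ∩ (openConn s v)ᶜ ∩ openConn b v ∩ (openConn s c ∪ openConn s c))
      = (prodBernoulli w0).real ((NAbv \ SAv) ∩ SAc) :=
    real_congr_of_sure hG1 fun ω hω => by
      rw [Set.mem_inter_iff, twoPort_mem_U_near L hsL hvL hsu1 (hωG ω hω) hbL, twoPort_X2_near L hsL hsu1 (hωG ω hω) hcL]
      simp only [Set.mem_inter_iff, Set.mem_sdiff]
      have := hss ω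
      tauto
  have IH' := IH
  rw [i1, i2, i3, i4] at IH'
  -- (4) assemble
  rw [ob U, ob X3, ob (U ∩ X3), ob (U ∩ X2), m1, m2, m3, m4, m5, m6, m7, m8]
  exact twoPort_real_AA (w e) _ _ _ _ _ _ (w e).2.1 (w e).2.2 measureReal_nonneg measureReal_nonneg IH'

/-- **(H), bridge step, case AB** (`b` on the port's side `L`, `c` beyond the bridge): (H)(w[e↦0]; u, x'; x', c) ⟹ (H)(w; u, v; b, c),
with Harris twice. [this work] -/
theorem twoPort_step_AB (w : Sym2 (Fin n) → unitInterval) (L : Set (Fin n)) {s u v x' b c : Fin n}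
    (hsL : s ∉ L) (hvL : v ∈ L) (hxL : x' ∉ L) (huL : u ∉ L) (hbL : b ∈ L) (hcL : c ∉ L)
    (hcross : ∀ x y : Fin n, x ∈ L → y ∉ L → y ≠ s → s(x, y) ≠ s(v, x') → w s(x, y) = 0)
    (IH : (prodBernoulli (Function.update w s(v, x') 0)).real (openConn s u ∩ (openConn s x')ᶜ ∩ openConn x' x') *
        (prodBernoulli (Function.update w s(v, x') 0)).real (openConn s c ∪ openConn u c ∪ openConn x' c)
      ≤ (prodBernoulli (Function.update w s(v, x') 0)).real
          (openConn s u ∩ (openConn s x')ᶜ ∩ openConn x' x' ∩ (openConn s c ∪ openConn u c ∪ openConn x' c))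
        + (prodBernoulli (Function.update w s(v, x') 0)).real
          (openConn s u ∩ (openConn s x')ᶜ ∩ openConn x' x' ∩ (openConn s c ∪ openConn u c))) :
    (prodBernoulli w).real (openConn s u ∩ (openConn s v)ᶜ ∩ openConn b v) *
        (prodBernoulli w).real (openConn s c ∪ openConn u c ∪ openConn v c)
      ≤ (prodBernoulli w).real (openConn s u ∩ (openConn s v)ᶜ ∩ openConn b v ∩ (openConn s c ∪ openConn u c ∪ openConn v c))
        + (prodBernoulli w).real (openConn s u ∩ (openConn s v)ᶜ ∩ openConn b v ∩ (openConn s c ∪ openConn u c)) := by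
  -- names
  set e : Sym2 (Fin n) := s(v, x')
  set w0 := Function.update w e 0 with hw0
  set w1 := Function.update w e 1
  set U : Set (BondConfig (Fin n)) := openConn s u ∩ (openConn s v)ᶜ ∩ openConn b v
  set X3 : Set (BondConfig (Fin n)) := openConn s c ∪ openConn u c ∪ openConn v c
  set X2 : Set (BondConfig (Fin n)) := openConn s c ∪ openConn u c
  set SAv : Set (BondConfig (Fin n)) := openConnIn (insert s L) s v
  set NAbv : Set (BondConfig (Fin n)) := openConnIn (insert s L) b v
  set SBu : Set (BondConfig (Fin n)) := openConnIn Lᶜ s u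
  set SBx : Set (BondConfig (Fin n)) := openConnIn Lᶜ s x'
  set SBc : Set (BondConfig (Fin n)) := openConnIn Lᶜ s c
  set NBuc : Set (BondConfig (Fin n)) := openConnIn Lᶜ u c
  set NBxc : Set (BondConfig (Fin n)) := openConnIn Lᶜ x' c
  -- (0) the bridge hypothesis under `w0`, the almost-sure set, independence
  have hw0cross : ∀ x y : Fin n, x ∈ L → y ∉ L → y ≠ s → w0 s(x, y) = 0 := by
    intro x y hx hy hys
    by_cases hxy : s(x, y) = e
    · rw [hxy, hw0, Function.update_self]
    · rw [hw0, Function.update_of_ne hxy]; exact hcross x y hx hy hys hxy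
  set G : Set (BondConfig (Fin n)) := {ω | ∀ e', w0 e' = 0 → e' ∉ ω}
  have hG1 : (prodBernoulli w0).real G = 1 := real_sureClosed w0
  have hωG : ∀ ω ∈ G, ∀ x y : Fin n, x ∈ L → y ∉ L → y ≠ s → s(x, y) ∉ ω :=
    fun ω hω x y hx hy hys => hω _ (hw0cross x y hx hy hys)
  have hm : ∀ X : Set (BondConfig (Fin n)), MeasurableSet X := fun _ => MeasurableSet.of_discrete
  have hdiff : ∀ {A B : Set (BondConfig (Fin n))} {K' : Set (Sym2 (Fin n))},
      DeterminedBy A K' → DeterminedBy B K' → DeterminedBy (A \ B) K' := by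
    intro A B K' hA hB
    rw [determinedBy_iff] at hA hB ⊢
    intro ω ω' h
    rw [Set.mem_sdiff, Set.mem_sdiff, hA ω ω' h, hB ω ω' h]
  have hinter : ∀ {A B : Set (BondConfig (Fin n))} {K' : Set (Sym2 (Fin n))},
      DeterminedBy A K' → DeterminedBy B K' → DeterminedBy (A ∩ B) K' := by
    intro A B K' hA hB
    rw [determinedBy_iff] at hA hB ⊢
    intro ω ω' h
    rw [Set.mem_inter_iff, Set.mem_inter_iff, hA ω ω' h, hB ω ω' h]
  have hunion : ∀ {A B : Set (BondConfig (Fin n))} {K' : Set (Sym2 (Fin n))},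
      DeterminedBy A K' → DeterminedBy B K' → DeterminedBy (A ∪ B) K' := by
    intro A B K' hA hB
    rw [determinedBy_iff] at hA hB ⊢
    intro ω ω' h
    rw [Set.mem_union, Set.mem_union, hA ω ω' h, hB ω ω' h]
  have hdn : ∀ x y : Fin n, DeterminedBy (openConnIn (insert s L) x y : Set (BondConfig (Fin n)))
      {z : Sym2 (Fin n) | ¬ z.IsDiag ∧ ∀ x ∈ z, x ∈ insert s L} := fun x y => IncStarCutVertex.determinedBy_openConnIn_offDiag _ x y
  have hdf : ∀ x y : Fin n, DeterminedBy (openConnIn Lᶜ x y : Set (BondConfig (Fin n)))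
      {z : Sym2 (Fin n) | ¬ z.IsDiag ∧ ∀ x ∈ z, x ∈ Lᶜ} := fun x y => IncStarCutVertex.determinedBy_openConnIn_offDiag _ x y
  have indep : ∀ {A B : Set (BondConfig (Fin n))}, DeterminedBy A {z : Sym2 (Fin n) | ¬ z.IsDiag ∧ ∀ x ∈ z, x ∈ insert s L} →
      DeterminedBy B {z : Sym2 (Fin n) | ¬ z.IsDiag ∧ ∀ x ∈ z, x ∈ Lᶜ} →
      (prodBernoulli w0).real (A ∩ B) = (prodBernoulli w0).real A * (prodBernoulli w0).real B :=
    fun hA hB => indep_blocks w0 L s hA hB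
  -- (1) one-bond decomposition and the lift
  have ob : ∀ A : Set (BondConfig (Fin n)),
      (prodBernoulli w).real A = (1 - (w e : ℝ)) * (prodBernoulli w0).real A + (w e : ℝ) * (prodBernoulli w1).real A := by
    intro A
    have hA : DeterminedBy A (↑(Finset.univ : Finset (Sym2 (Fin n))) : Set (Sym2 (Fin n))) := by
      rw [determinedBy_iff]
      intro ω ω' h
      rw [Finset.coe_univ, Set.inter_univ, Set.inter_univ] at h
      rw [h]
    exact prodBernoulli_real_oneBond hA w (Finset.mem_univ e)
  have lift : ∀ A : Set (BondConfig (Fin n)),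
      (prodBernoulli w1).real A = (prodBernoulli w0).real ((fun ω : BondConfig (Fin n) => insert e ω) ⁻¹' A) :=
    fun A => tieLiftOne_real_one_eq w e A
  -- (2) the eight moments in block form
  have hDA : DeterminedBy (NAbv \ SAv) {z : Sym2 (Fin n) | ¬ z.IsDiag ∧ ∀ x ∈ z, x ∈ insert s L} := hdiff (hdn b v) (hdn s v)
  have hC0 : DeterminedBy (SBc ∪ NBuc) {z : Sym2 (Fin n) | ¬ z.IsDiag ∧ ∀ x ∈ z, x ∈ Lᶜ} := hunion (hdf s c) (hdf u c)
  have hC1 : DeterminedBy (SBc ∪ NBuc ∪ NBxc) {z : Sym2 (Fin n) | ¬ z.IsDiag ∧ ∀ x ∈ z, x ∈ Lᶜ} := hunion hC0 (hdf x' c)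
  have hU' : DeterminedBy (SBu \ SBx) {z : Sym2 (Fin n) | ¬ z.IsDiag ∧ ∀ x ∈ z, x ∈ Lᶜ} := hdiff (hdf s u) (hdf s x')
  have m1 : (prodBernoulli w0).real U = (prodBernoulli w0).real (NAbv \ SAv) * (prodBernoulli w0).real SBu := by
    rw [← indep hDA (hdf s u)]
    refine real_congr_of_sure hG1 fun ω hω => ?_
    rw [twoPort_mem_U_near L hsL hvL huL (hωG ω hω) hbL, Set.mem_inter_iff, Set.mem_sdiff]
  have m2 : (prodBernoulli w1).real U = (prodBernoulli w0).real (NAbv \ SAv) * (prodBernoulli w0).real (SBu \ SBx) := by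
    rw [lift, ← indep hDA hU']
    refine real_congr_of_sure hG1 fun ω hω => ?_
    rw [Set.mem_preimage, twoPort_lift_U_near L hsL hvL hxL huL (hωG ω hω) hbL, Set.mem_inter_iff, Set.mem_sdiff, Set.mem_sdiff]
  have m3 : (prodBernoulli w0).real X3 = (prodBernoulli w0).real (SBc ∪ NBuc) :=
    real_congr_of_sure hG1 fun ω hω => by rw [twoPort_mem_X3_far L hsL hvL huL (hωG ω hω) hcL, Set.mem_union]
  have m4 : (prodBernoulli w1).real X3 = (prodBernoulli w0).real (SBc ∪ NBuc ∪ NBxc) := by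
    rw [lift]
    exact real_congr_of_sure hG1 fun ω hω => by
      rw [Set.mem_preimage, twoPort_lift_X3_far L hsL hvL hxL huL (hωG ω hω) hcL, Set.mem_union, Set.mem_union, or_assoc]
  have m5 : (prodBernoulli w0).real (U ∩ X3)
      = (prodBernoulli w0).real (NAbv \ SAv) * (prodBernoulli w0).real (SBu ∩ (SBc ∪ NBuc)) := by
    rw [← indep hDA (hinter (hdf s u) hC0)]
    refine real_congr_of_sure hG1 fun ω hω => ?_
    rw [Set.mem_inter_iff, twoPort_mem_U_near L hsL hvL huL (hωG ω hω) hbL, twoPort_mem_X3_far L hsL hvL huL (hωG ω hω) hcL]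
    simp only [Set.mem_inter_iff, Set.mem_sdiff, Set.mem_union]
    tauto
  have m6 : (prodBernoulli w1).real (U ∩ X3)
      = (prodBernoulli w0).real (NAbv \ SAv) * (prodBernoulli w0).real ((SBu \ SBx) ∩ (SBc ∪ NBuc ∪ NBxc)) := by
    rw [lift, ← indep hDA (hinter hU' hC1)]
    refine real_congr_of_sure hG1 fun ω hω => ?_
    rw [Set.mem_preimage, Set.mem_inter_iff, twoPort_lift_U_near L hsL hvL hxL huL (hωG ω hω) hbL,
      twoPort_lift_X3_far L hsL hvL hxL huL (hωG ω hω) hcL]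
    simp only [Set.mem_inter_iff, Set.mem_sdiff, Set.mem_union]
    tauto
  have m7 : (prodBernoulli w0).real (U ∩ X2)
      = (prodBernoulli w0).real (NAbv \ SAv) * (prodBernoulli w0).real (SBu ∩ (SBc ∪ NBuc)) := by
    rw [← indep hDA (hinter (hdf s u) hC0)]
    refine real_congr_of_sure hG1 fun ω hω => ?_
    rw [Set.mem_inter_iff, twoPort_mem_U_near L hsL hvL huL (hωG ω hω) hbL, twoPort_X2_far L hsL huL (hωG ω hω) hcL]
    simp only [Set.mem_inter_iff, Set.mem_sdiff, Set.mem_union]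
    tauto
  have m8 : (prodBernoulli w1).real (U ∩ X2)
      = (prodBernoulli w0).real (NAbv \ SAv) * (prodBernoulli w0).real ((SBu \ SBx) ∩ (SBc ∪ NBuc)) := by
    rw [lift, ← indep hDA (hinter hU' hC0)]
    refine real_congr_of_sure hG1 fun ω hω => ?_
    rw [Set.mem_preimage, Set.mem_inter_iff]
    constructor
    · rintro ⟨hU, hX⟩
      rw [twoPort_lift_X2_far L hsL hvL hxL huL (hωG ω hω) hcL hU] at hX
      rw [twoPort_lift_U_near L hsL hvL hxL huL (hωG ω hω) hbL] at hU
      simp only [Set.mem_inter_iff, Set.mem_sdiff, Set.mem_union]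
      tauto
    · intro h
      simp only [Set.mem_inter_iff, Set.mem_sdiff, Set.mem_union] at h
      have hU : insert e ω ∈ U := by
        rw [twoPort_lift_U_near L hsL hvL hxL huL (hωG ω hω) hbL]; tauto
      rw [twoPort_lift_X2_far L hsL hvL hxL huL (hωG ω hω) hcL hU]
      exact ⟨hU, h.2.2⟩
  -- (3) the induction instance `(u, x'; x', c)` in block form (all far)
  have hs2 : s ∈ Lᶜ := hsL
  have hx2 : x' ∈ Lᶜ := hxL
  have hu2 : u ∈ Lᶜ := huL
  have hc2 : c ∈ Lᶜ := hcL
  have hxx : ∀ ω : BondConfig (Fin n), ω ∈ openConnIn Lᶜ x' x' := fun ω => ⟨hxL, hxL, SimpleGraph.Reachable.refl _⟩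
  have cU : ∀ ω ∈ G, (ω ∈ openConn s u ∩ (openConn s x')ᶜ ∩ openConn x' x' ↔ ω ∈ SBu \ SBx) := fun ω hω => by
    rw [Set.mem_inter_iff, Set.mem_inter_iff, Set.mem_compl_iff, Set.mem_sdiff, bridge_conn_rr L hsL (hωG ω hω) hs2 hu2,
      bridge_conn_rr L hsL (hωG ω hω) hs2 hx2, bridge_conn_rr L hsL (hωG ω hω) hx2 hx2]
    have := hxx ω
    tauto
  have cX3 : ∀ ω ∈ G, (ω ∈ openConn s c ∪ openConn u c ∪ openConn x' c ↔ ω ∈ SBc ∪ NBuc ∪ NBxc) := fun ω hω => by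
    rw [Set.mem_union, Set.mem_union, Set.mem_union, Set.mem_union, bridge_conn_rr L hsL (hωG ω hω) hs2 hc2,
      bridge_conn_rr L hsL (hωG ω hω) hu2 hc2, bridge_conn_rr L hsL (hωG ω hω) hx2 hc2]
  have cX2 : ∀ ω ∈ G, (ω ∈ openConn s c ∪ openConn u c ↔ ω ∈ SBc ∪ NBuc) := fun ω hω => by
    rw [Set.mem_union, Set.mem_union, bridge_conn_rr L hsL (hωG ω hω) hs2 hc2, bridge_conn_rr L hsL (hωG ω hω) hu2 hc2]
  have i1 : (prodBernoulli w0).real (openConn s u ∩ (openConn s x')ᶜ ∩ openConn x' x') = (prodBernoulli w0).real (SBu \ SBx) :=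
    real_congr_of_sure hG1 cU
  have i2 : (prodBernoulli w0).real (openConn s c ∪ openConn u c ∪ openConn x' c)
      = (prodBernoulli w0).real (SBc ∪ NBuc ∪ NBxc) := real_congr_of_sure hG1 cX3
  have i3 : (prodBernoulli w0).real (openConn s u ∩ (openConn s x')ᶜ ∩ openConn x' x' ∩ (openConn s c ∪ openConn u c ∪ openConn x' c))
      = (prodBernoulli w0).real ((SBu \ SBx) ∩ (SBc ∪ NBuc ∪ NBxc)) :=
    real_congr_of_sure hG1 fun ω hω => by rw [Set.mem_inter_iff, cU ω hω, cX3 ω hω, Set.mem_inter_iff]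
  have i4 : (prodBernoulli w0).real (openConn s u ∩ (openConn s x')ᶜ ∩ openConn x' x' ∩ (openConn s c ∪ openConn u c))
      = (prodBernoulli w0).real ((SBu \ SBx) ∩ (SBc ∪ NBuc)) :=
    real_congr_of_sure hG1 fun ω hω => by rw [Set.mem_inter_iff, cU ω hω, cX2 ω hω, Set.mem_inter_iff]
  have IH' := IH
  rw [i1, i2, i3, i4] at IH'
  -- (4) Harris twice, monotonicity, and the splitting `P(S^B_u) = P(S^B_u ∖ S^B_x') + P(S^B_u ∩ S^B_x')`
  have hupS : ∀ x y : Fin n, IsUpperSet (openConnIn Lᶜ x y : Set (BondConfig (Fin n))) := fun x y => isUpperSet_openConnIn _ x y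
  have h1 : (prodBernoulli w0).real SBu * (prodBernoulli w0).real (SBc ∪ NBuc) ≤ (prodBernoulli w0).real (SBu ∩ (SBc ∪ NBuc)) :=
    prodBernoulli_harris w0 (hupS s u) ((hupS s c).union (hupS u c)) (hm _) (hm _)
  have h2a : (prodBernoulli w0).real (SBu ∩ SBx) * (prodBernoulli w0).real NBxc ≤ (prodBernoulli w0).real (SBu ∩ SBx ∩ NBxc) :=
    prodBernoulli_harris w0 ((hupS s u).inter (hupS s x')) (hupS x' c) (hm _) (hm _)
  have h2b : (prodBernoulli w0).real (SBu ∩ SBx ∩ NBxc) ≤ (prodBernoulli w0).real (SBu ∩ (SBc ∪ NBuc)) := by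
    refine measureReal_mono (fun ω hω => ?_) (measure_ne_top _ _)
    obtain ⟨⟨hu', hx'⟩, hxc⟩ := hω
    exact ⟨hu', Or.inl (PlanarDuality.openConnIn_trans hx' hxc)⟩
  have h3 : (prodBernoulli w0).real (SBc ∪ NBuc ∪ NBxc) ≤ (prodBernoulli w0).real (SBc ∪ NBuc) + (prodBernoulli w0).real NBxc :=
    measureReal_union_le _ _
  have hX : (prodBernoulli w0).real (SBc ∪ NBuc) ≤ (prodBernoulli w0).real (SBc ∪ NBuc ∪ NBxc) :=
    measureReal_mono Set.subset_union_left (measure_ne_top _ _)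
  have h4 : (prodBernoulli w0).real SBu = (prodBernoulli w0).real (SBu \ SBx) + (prodBernoulli w0).real (SBu ∩ SBx) := by
    rw [add_comm, measureReal_inter_add_sdiff (hm _)]
  -- (5) assemble
  rw [ob U, ob X3, ob (U ∩ X3), ob (U ∩ X2), m1, m2, m3, m4, m5, m6, m7, m8]
  exact twoPort_real_AB (w e) _ _ _ _ _ _ _ _ _ _ (w e).2.1 (w e).2.2 measureReal_nonneg measureReal_nonneg h4 IH' h1
    (le_trans h2a h2b) h3 hX

end IncStar

end Summit.CriticalPhenomena.PercolationContinuityZ3.Theorems
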